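import Summits.CriticalPhenomena.PercolationContinuityZ3.Theorems.PercNearOneGluingNoHeavyQuantFarHubFamilyTransfer
import HarnessLib

/-!
# QUANT lane R8, front "FAR beyond trees", layer one — HUB FAMILIES V: HUB ELIMINATION — the internal numbers of an ARBITRARY pendant block with a
# family of hubs are explicit functionals of the CORE REACH LAW `ρ(R) = P_w(reach pattern of the anchors = R)` and the hub laws

builds on p205010 (kernel theorem, internal audit signed; external expert review pending)

Support file (`--supports stmt-CriticalPhenomena-4575`), seat `prim-quant-p1` (gen 22); memo
`run/shared/lean/prim/quant/prim-quant-p1-g22/FOR-LEAD-KHUB.md` §6.  Standard axioms; no sorries.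

Setting of `…QuantFarHubFamilyTransfer`.  With `E_j = {c ↔ v j in core}`, `W_j` the loaded hub counts, `reachPat R = {∀ j ∈ J, E_j ⟺ j ∈ R}` (`R ⊆ J`):
* `Block.coreCountF = Σ_j 𝟙[E_j]·W_j` is the block count almost surely (`Block.real_card_on_eq_coreCountF`, from `card_on_eq_family`);
* `Block.real_eq_sum_reachPat` — partition over the `2^|J|` reach patterns; `Block.real_reachPat_inter_allZero/oneAt` — on a pattern the hubs are
  independent of the core and of each other (`prodBernoulli_real_inter_biInter_of_determinedBy`);
* **`Block.real_blockCount_law`**: `P_w(X ≥ 1) = 1 − Σ_{R ⊆ J} ρ(R)·∏_{j∈R} z_j` and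
  `P_w(X ≥ 2) = 1 − Σ_{R ⊆ J} ρ(R)·(∏_{j∈R} z_j + Σ_{i∈R} s_i ∏_{j∈R∖i} z_j)`.
Together with `Block.farLayerOne_hubFamily` this reduces FAR(1) block-locality for ANY pendant 2-connected core to an inequality between the core
reach law `ρ` (a function of the core alone) and the hub laws — the object the next front has to analyse (memo §5).
[cite: Grimmett1999, §1.3 p. 10; §2.2]; bookkeeping [this work].
-/

noncomputable section

namespace Summit.CriticalPhenomena.PercolationContinuityZ3.Theorems

namespace Quant

namespace Block

open Finset MeasureTheory Set
open Literature.Probability.LatticeModels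
open Literature.Probability.Percolation
open scoped Classical

variable {n : ℕ}

/-- A sum of naturals is `1` iff exactly one term is `1` and the others vanish. [folklore] -/
theorem nat_sum_eq_one_iff {ι : Type*} (R : Finset ι) (f : ι → ℕ) :
    ∑ j ∈ R, f j = 1 ↔ ∃ i ∈ R, f i = 1 ∧ ∀ j ∈ R, j ≠ i → f j = 0 := by
  constructor
  · intro h
    have hne : ∃ i ∈ R, f i ≠ 0 := by
      by_contra hall
      have h0 : ∑ j ∈ R, f j = 0 := Finset.sum_eq_zero fun i hi => by by_contra hf; exact hall ⟨i, hi, hf⟩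
      omega
    obtain ⟨i, hi, hfi⟩ := hne
    have hsplit := Finset.add_sum_erase R f hi
    have hle : f i ≤ 1 := by rw [← h]; exact Finset.single_le_sum (fun _ _ => Nat.zero_le _) hi
    have hfi1 : f i = 1 := by omega
    refine ⟨i, hi, hfi1, fun j hj hji => ?_⟩
    have hrest : ∑ x ∈ R.erase i, f x = 0 := by omega
    exact (Finset.sum_eq_zero_iff.1 hrest) j (Finset.mem_erase.2 ⟨hji, hj⟩)
  · rintro ⟨i, hi, hfi, hrest⟩
    rw [← Finset.add_sum_erase R f hi, hfi, Finset.sum_eq_zero (fun j hj => hrest j (Finset.mem_of_mem_erase hj) (Finset.ne_of_mem_erase hj))]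
    rfl

/-- The block count read through the core: `Σ_{j ∈ J} 𝟙[c ↔ v j in core]·W_j`. [this work] -/
def coreCountF (c : Fin n) (Z : Finset (Fin n)) (J : Finset ℕ) (v : ℕ → Fin n) (S : ℕ → Finset (Fin n)) (A : Finset (Fin n))
    (ω : BondConfig (Fin n)) : ℕ :=
  ∑ j ∈ J, if core Z (hubs J S) ω ∈ openConn c (v j) then hubCount v S A j ω else 0

/-- The REACH PATTERN `R`: exactly the anchors `v j`, `j ∈ R`, are joined to `c` through the core. [this work] -/
def reachPat (c : Fin n) (Z : Finset (Fin n)) (J : Finset ℕ) (v : ℕ → Fin n) (S : ℕ → Finset (Fin n)) (R : Finset ℕ) : Set (BondConfig (Fin n)) :=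
  {ω | ∀ j ∈ J, (core Z (hubs J S) ω ∈ openConn c (v j) ↔ j ∈ R)}

section Family

variable {c : Fin n} {Z : Finset (Fin n)} {J : Finset ℕ} {v : ℕ → Fin n} {S : ℕ → Finset (Fin n)} (H : IsHubFamily c Z J v S)
  (w : Sym2 (Fin n) → unitInterval) (A : Finset (Fin n))
  (hangS : ∀ j ∈ J, ∀ x y : Fin n, x ≠ y → x ∈ S j → y ∉ S j → y ≠ v j → (w s(x, y) : ℝ) = 0)

include H in
/-- The block count is the core count on configurations good for every hub. [this work] -/
theorem card_on_eq_coreCountF {ω : BondConfig (Fin n)} (hgood : ∀ j ∈ J, Good (v j) (S j) ω) (hA : ∀ a ∈ A ∩ Z, ∃ j ∈ J, a = v j ∨ a ∈ S j) :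
    ((A ∩ Z).filter fun a => onZ Z ω ∈ openConn c a).card = coreCountF c Z J v S A ω := by
  rw [card_on_eq_family H hgood hA]; rfl

include H hangS in
/-- Events read off the block count have the probability of the same events read off the core count. [this work] -/
theorem real_card_on_eq_coreCountF (hA : ∀ a ∈ A ∩ Z, ∃ j ∈ J, a = v j ∨ a ∈ S j) (P : ℕ → Prop) :
    (prodBernoulli w).real {ω | P (((A ∩ Z).filter fun a => onZ Z ω ∈ openConn c a).card)} = (prodBernoulli w).real {ω | P (coreCountF c Z J v S A ω)} :=
  real_congr_hubs w hangS _ _ fun ω hω => by simp only [mem_setOf_eq, card_on_eq_coreCountF H A hω hA]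

omit H in
/-- On the reach pattern `R ⊆ J` the core count is the unit count of the hubs in `R`. [this work] -/
theorem coreCountF_eq_on_reachPat {R : Finset ℕ} (hR : R ⊆ J) {ω : BondConfig (Fin n)} (hω : ω ∈ reachPat c Z J v S R) :
    coreCountF c Z J v S A ω = ∑ j ∈ R, hubCount v S A j ω := by
  unfold coreCountF
  rw [← Finset.sum_subset hR (fun j hj hjR => by rw [if_neg (fun h => hjR ((hω j hj).1 h))])]
  exact Finset.sum_congr rfl fun j hj => by rw [if_pos ((hω j (hR hj)).2 hj)]

/-- **Partition over the reach patterns**: `P_w(E) = Σ_{R ⊆ J} P_w(E ∩ reachPat R)`. [this work] -/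
theorem real_eq_sum_reachPat (E : Set (BondConfig (Fin n))) :
    (prodBernoulli w).real E = ∑ R ∈ J.powerset, (prodBernoulli w).real (E ∩ reachPat c Z J v S R) := by
  have hmeas : ∀ U : Set (BondConfig (Fin n)), MeasurableSet U := fun U => (Set.toFinite U).measurableSet
  have hE : E = ⋃ R ∈ J.powerset, (E ∩ reachPat c Z J v S R) := by
    ext ω
    simp only [Set.mem_iUnion, Set.mem_inter_iff, exists_and_left, exists_prop]
    constructor
    · intro hω
      refine ⟨hω, J.filter (fun j => core Z (hubs J S) ω ∈ openConn c (v j)), Finset.mem_powerset.2 (Finset.filter_subset _ _), fun j hj => ?_⟩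
      rw [Finset.mem_filter]
      exact ⟨fun h => ⟨hj, h⟩, fun h => h.2⟩
    · rintro ⟨hω, -⟩; exact hω
  conv_lhs => rw [hE]
  refine measureReal_biUnion_finset (fun R hR R' hR' hRR' => ?_) (fun R _ => hmeas _)
  refine Disjoint.mono Set.inter_subset_right Set.inter_subset_right (Set.disjoint_left.2 fun ω h1 h2 => hRR' ?_)
  ext j
  by_cases hj : j ∈ J
  · exact (h1 j hj).symm.trans (h2 j hj)
  · exact ⟨fun h => absurd (Finset.mem_powerset.1 hR h) hj, fun h => absurd (Finset.mem_powerset.1 hR' h) hj⟩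

/-- A reach pattern is determined by the core pairs, hence off the hub pairs of the hubs in `R ⊆ J`. [this work] -/
theorem determinedBy_reachPat {R : Finset ℕ} (hR : R ⊆ J) :
    DeterminedBy (reachPat c Z J v S R) (⋃ j ∈ R, (↑(hubPairs (S j) (v j)) : Set (Sym2 (Fin n))))ᶜ := by
  refine (determinedBy_core Z (hubs J S) fun η => ∀ j ∈ J, (η ∈ openConn c (v j) ↔ j ∈ R)).mono fun e he hmem => ?_
  simp only [Set.mem_iUnion] at hmem
  obtain ⟨j, hj, hej⟩ := hmem
  exact Finset.disjoint_left.1 (disjoint_corePairs_hubPairs (Z := Z) (J := J) (v := v) (S := S) (hR hj)) (Finset.mem_coe.1 he) (Finset.mem_coe.1 hej)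

include H in
/-- **On a pattern the hubs are independent of the core and of each other**: for events `C j` read off the hub counts,
`P_w(reachPat R ∩ ⋂_{j∈R} C j) = P_w(reachPat R) · ∏_{j∈R} P_w(C j)`. [this work] -/
theorem real_reachPat_inter_biInter {R : Finset ℕ} (hR : R ⊆ J) (P : ℕ → ℕ → Prop) :
    (prodBernoulli w).real (reachPat c Z J v S R ∩ ⋂ j ∈ R, {ω | P j (hubCount v S A j ω)}) =
      (prodBernoulli w).real (reachPat c Z J v S R) * ∏ j ∈ R, (prodBernoulli w).real {ω | P j (hubCount v S A j ω)} := by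
  have hmeas : ∀ U : Set (BondConfig (Fin n)), MeasurableSet U := fun U => (Set.toFinite U).measurableSet
  exact prodBernoulli_real_inter_biInter_of_determinedBy w R (fun j => hubPairs (S j) (v j))
    (fun i hi j hj hij => disjoint_hubPairs_fd H (hR (Finset.mem_coe.1 hi)) (hR (Finset.mem_coe.1 hj)) hij)
    (fun j _ => (readsOff_hubCount v S A j).determinedBy (P j)) (fun j _ => hmeas _) (determinedBy_reachPat hR) (hmeas _)

include H in
/-- All hubs of the pattern empty: `P_w(reachPat R ∩ {Σ_{j∈R} W_j = 0}) = P_w(reachPat R)·∏_{j∈R} z_j`. [this work] -/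
theorem real_reachPat_inter_allZero {R : Finset ℕ} (hR : R ⊆ J) :
    (prodBernoulli w).real (reachPat c Z J v S R ∩ {ω | ∑ j ∈ R, hubCount v S A j ω = 0}) =
      (prodBernoulli w).real (reachPat c Z J v S R) * ∏ j ∈ R, hz v S A w j := by
  have e : {ω : BondConfig (Fin n) | ∑ j ∈ R, hubCount v S A j ω = 0} = ⋂ j ∈ R, {ω | hubCount v S A j ω = 0} := by
    ext ω; simp only [mem_setOf_eq, Set.mem_iInter, Finset.sum_eq_zero_iff]
  rw [e, real_reachPat_inter_biInter H w A hR (fun _ k => k = 0)]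
  rfl

include H in
/-- Exactly one unit, at hub `i`: `P_w(reachPat R ∩ {W_i = 1, W_j = 0 (j ≠ i)}) = P_w(reachPat R)·s_i·∏_{j∈R∖i} z_j`. [this work] -/
theorem real_reachPat_inter_oneAt {R : Finset ℕ} (hR : R ⊆ J) {i : ℕ} (hi : i ∈ R) :
    (prodBernoulli w).real (reachPat c Z J v S R ∩ {ω | hubCount v S A i ω = 1 ∧ ∀ j ∈ R, j ≠ i → hubCount v S A j ω = 0}) =
      (prodBernoulli w).real (reachPat c Z J v S R) * (hs v S A w i * ∏ j ∈ R.erase i, hz v S A w j) := by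
  have e : {ω : BondConfig (Fin n) | hubCount v S A i ω = 1 ∧ ∀ j ∈ R, j ≠ i → hubCount v S A j ω = 0} =
      ⋂ j ∈ R, {ω | (if j = i then (fun k => k = 1) else (fun k => k = 0)) (hubCount v S A j ω)} := by
    ext ω
    simp only [mem_setOf_eq, Set.mem_iInter]
    constructor
    · rintro ⟨h1, h0⟩ j hj
      by_cases hji : j = i
      · subst hji; simp [h1]
      · simp [hji, h0 j hj hji]
    · intro h
      refine ⟨by simpa using h i hi, fun j hj hji => by simpa [hji] using h j hj⟩
  rw [e, real_reachPat_inter_biInter H w A hR (fun j => if j = i then (fun k => k = 1) else (fun k => k = 0)), ← Finset.mul_prod_erase R _ hi]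
  congr 1
  rw [if_pos rfl]
  congr 1
  exact Finset.prod_congr rfl fun j hj => by rw [if_neg (Finset.ne_of_mem_erase hj)]; rfl

include H in
/-- **`P_w(coreCountF = 0) = Σ_{R ⊆ J} ρ(R)·∏_{j∈R} z_j`.** [this work] -/
theorem real_coreCountF_eq_zero :
    (prodBernoulli w).real {ω | coreCountF c Z J v S A ω = 0} =
      ∑ R ∈ J.powerset, (prodBernoulli w).real (reachPat c Z J v S R) * ∏ j ∈ R, hz v S A w j := by
  rw [real_eq_sum_reachPat w]
  refine Finset.sum_congr rfl fun R hR => ?_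
  have hRJ : R ⊆ J := Finset.mem_powerset.1 hR
  rw [← real_reachPat_inter_allZero H w A hRJ]
  congr 1
  ext ω
  simp only [Set.mem_inter_iff, mem_setOf_eq]
  constructor
  · rintro ⟨h0, hp⟩; exact ⟨hp, by rw [← coreCountF_eq_on_reachPat A hRJ hp]; exact h0⟩
  · rintro ⟨hp, h0⟩; exact ⟨by rw [coreCountF_eq_on_reachPat A hRJ hp]; exact h0, hp⟩

include H in
/-- **`P_w(coreCountF ≤ 1) = Σ_{R ⊆ J} ρ(R)·(∏_{j∈R} z_j + Σ_{i∈R} s_i ∏_{j∈R∖i} z_j)`.** [this work] -/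
theorem real_coreCountF_le_one :
    (prodBernoulli w).real {ω | coreCountF c Z J v S A ω ≤ 1} =
      ∑ R ∈ J.powerset, (prodBernoulli w).real (reachPat c Z J v S R) *
        (∏ j ∈ R, hz v S A w j + ∑ i ∈ R, hs v S A w i * ∏ j ∈ R.erase i, hz v S A w j) := by
  have hmeas : ∀ U : Set (BondConfig (Fin n)), MeasurableSet U := fun U => (Set.toFinite U).measurableSet
  rw [real_eq_sum_reachPat w]
  refine Finset.sum_congr rfl fun R hR => ?_
  have hRJ : R ⊆ J := Finset.mem_powerset.1 hR
  set Pat := reachPat c Z J v S R with hPat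
  set Z0 := {ω : BondConfig (Fin n) | ∑ j ∈ R, hubCount v S A j ω = 0} with hZ0
  set O : ℕ → Set (BondConfig (Fin n)) := fun i => {ω | hubCount v S A i ω = 1 ∧ ∀ j ∈ R, j ≠ i → hubCount v S A j ω = 0} with hO
  -- the event on the pattern: all zero, or exactly one unit at some `i ∈ R`
  have e : {ω | coreCountF c Z J v S A ω ≤ 1} ∩ Pat = (Pat ∩ Z0) ∪ ⋃ i ∈ R, (Pat ∩ O i) := by
    ext ω
    rw [Set.mem_union, Set.mem_iUnion₂]
    constructor
    · rintro ⟨h1, hp⟩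
      have h1' : ∑ j ∈ R, hubCount v S A j ω ≤ 1 := by
        have := h1; simp only [mem_setOf_eq] at this; rwa [coreCountF_eq_on_reachPat A hRJ hp] at this
      rcases Nat.lt_or_ge (∑ j ∈ R, hubCount v S A j ω) 1 with h | h
      · exact Or.inl ⟨hp, show ∑ j ∈ R, hubCount v S A j ω = 0 by omega⟩
      · obtain ⟨i, hi, hfi, hrest⟩ := (nat_sum_eq_one_iff R (fun j => hubCount v S A j ω)).1 (by omega)
        exact Or.inr ⟨i, hi, hp, hfi, hrest⟩
    · rintro (⟨hp, h0⟩ | ⟨i, hi, hp, hfi, hrest⟩)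
      · refine ⟨?_, hp⟩
        show coreCountF c Z J v S A ω ≤ 1
        rw [coreCountF_eq_on_reachPat A hRJ hp]
        have : ∑ j ∈ R, hubCount v S A j ω = 0 := h0
        omega
      · refine ⟨?_, hp⟩
        show coreCountF c Z J v S A ω ≤ 1
        rw [coreCountF_eq_on_reachPat A hRJ hp, (nat_sum_eq_one_iff R (fun j => hubCount v S A j ω)).2 ⟨i, hi, hfi, hrest⟩]
  have hdO : (↑R : Set ℕ).PairwiseDisjoint fun i => Pat ∩ O i := by
    intro i hi i' _ hii'
    rw [Function.onFun, Set.disjoint_left]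
    rintro ω ⟨-, h1, -⟩ ⟨-, -, hrest'⟩
    have := hrest' i (Finset.mem_coe.1 hi) hii'
    omega
  have hdZ : Disjoint (Pat ∩ Z0) (⋃ i ∈ R, (Pat ∩ O i)) := by
    rw [Set.disjoint_left]
    rintro ω ⟨-, h0⟩ h
    rw [Set.mem_iUnion₂] at h
    obtain ⟨i, hi, -, h1, -⟩ := h
    have h0' : ∑ j ∈ R, hubCount v S A j ω = 0 := h0
    have : hubCount v S A i ω = 0 := (Finset.sum_eq_zero_iff.1 h0') i hi
    omega
  rw [e, measureReal_union hdZ (Finset.measurableSet_biUnion R fun i _ => hmeas _) (measure_ne_top _ _) (measure_ne_top _ _),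
    measureReal_biUnion_finset hdO (fun i _ => hmeas _), real_reachPat_inter_allZero H w A hRJ,
    Finset.sum_congr rfl fun i hi => real_reachPat_inter_oneAt H w A hRJ hi, ← Finset.mul_sum, mul_add]

include H hangS in
/-- **HUB ELIMINATION**: the internal numbers of the block through the core reach law `ρ(R) = P_w(reachPat R)` and the hub laws:
`P_w(X ≥ 1) = 1 − Σ_R ρ(R)∏_{R} z` and `P_w(X ≥ 2) = 1 − Σ_R ρ(R)(∏_R z + Σ_{i∈R} s_i ∏_{R∖i} z)`. [this work] -/
theorem real_blockCount_law (hA : ∀ a ∈ A ∩ Z, ∃ j ∈ J, a = v j ∨ a ∈ S j) :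
    (prodBernoulli w).real {ω | 1 ≤ ((A ∩ Z).filter fun a => onZ Z ω ∈ openConn c a).card} =
        1 - ∑ R ∈ J.powerset, (prodBernoulli w).real (reachPat c Z J v S R) * ∏ j ∈ R, hz v S A w j ∧
      (prodBernoulli w).real {ω | 2 ≤ ((A ∩ Z).filter fun a => onZ Z ω ∈ openConn c a).card} =
        1 - ∑ R ∈ J.powerset, (prodBernoulli w).real (reachPat c Z J v S R) *
          (∏ j ∈ R, hz v S A w j + ∑ i ∈ R, hs v S A w i * ∏ j ∈ R.erase i, hz v S A w j) := by
  have hmeas : ∀ U : Set (BondConfig (Fin n)), MeasurableSet U := fun U => (Set.toFinite U).measurableSet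
  constructor
  · rw [real_card_on_eq_coreCountF H w A hangS hA (fun k => 1 ≤ k), ← real_coreCountF_eq_zero H w A]
    have : {ω : BondConfig (Fin n) | 1 ≤ coreCountF c Z J v S A ω} = {ω | coreCountF c Z J v S A ω = 0}ᶜ := by
      ext ω; simp only [mem_setOf_eq, Set.mem_compl_iff]; omega
    rw [this, probReal_compl_eq_one_sub (hmeas _)]
  · rw [real_card_on_eq_coreCountF H w A hangS hA (fun k => 2 ≤ k), ← real_coreCountF_le_one H w A]
    have : {ω : BondConfig (Fin n) | 2 ≤ coreCountF c Z J v S A ω} = {ω | coreCountF c Z J v S A ω ≤ 1}ᶜ := by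
      ext ω; simp only [mem_setOf_eq, Set.mem_compl_iff]; omega
    rw [this, probReal_compl_eq_one_sub (hmeas _)]

omit H in
/-- The core marginal of an anchor through the reach law: `P_w(c ↔ v j in core) = Σ_{R ⊆ J, j ∈ R} ρ(R)`. [this work] -/
theorem real_coreReach_eq_sum_reachPat {j : ℕ} (hj : j ∈ J) :
    (prodBernoulli w).real {ω | core Z (hubs J S) ω ∈ openConn c (v j)} =
      ∑ R ∈ J.powerset.filter (fun R => j ∈ R), (prodBernoulli w).real (reachPat c Z J v S R) := by
  rw [real_eq_sum_reachPat w, Finset.sum_filter]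
  refine Finset.sum_congr rfl fun R _ => ?_
  by_cases hjR : j ∈ R
  · rw [if_pos hjR]
    congr 1
    ext ω
    exact ⟨fun h => h.2, fun h => ⟨(h j hj).2 hjR, h⟩⟩
  · rw [if_neg hjR]
    have : {ω : BondConfig (Fin n) | core Z (hubs J S) ω ∈ openConn c (v j)} ∩ reachPat c Z J v S R = ∅ := by
      ext ω
      simp only [Set.mem_inter_iff, mem_setOf_eq, Set.mem_empty_iff_false, iff_false, not_and]
      exact fun h hp => hjR ((hp j hj).1 h)
    rw [this, measureReal_empty]

include H hangS in
/-- **FAR(1) BLOCK-LOCALITY FOR AN ARBITRARY PENDANT BLOCK, LAW-LEVEL FORM**: the domination hypothesis of `Block.farLayerOne_hubFamily` stated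
through the core reach law `ρ(R) = P_w(reachPat R)` and the hub laws only. [this work] -/
theorem farLayerOne_hubFamily_law (hangZ : ∀ x y : Fin n, x ≠ y → x ∈ Z → y ∉ Z → y ≠ c → (w s(x, y) : ℝ) = 0)
    (hA : ∀ a ∈ A ∩ Z, ∃ j ∈ J, a = v j ∨ a ∈ S j) {o : Fin n} (ho : o ∉ Z) (hAZ : (A ∩ Z).Nonempty) (t : ℝ)
    (hdom : ∀ q : ℝ, 0 ≤ q → (∀ i, i < (floadedList J v S A).length → q ≤ (decChain c Z J v S A w).m (i + 1) * (decChain c Z J v S A w).u (i + 1)) →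
      ∃ l : ℝ, 0 ≤ l ∧ l ≤ 1 ∧
        l * TwoChain.hProd (floadedList J v S A).length (decChain c Z J v S A w) + (1 - l) * q ≤
          1 - ∑ R ∈ J.powerset, (prodBernoulli w).real (reachPat c Z J v S R) * ∏ j ∈ R, hz v S A w j ∧
        l * TwoChain.tProd (floadedList J v S A).length (decChain c Z J v S A w) + (1 - l) * q ≤
          1 - ∑ R ∈ J.powerset, (prodBernoulli w).real (reachPat c Z J v S R) *
            (∏ j ∈ R, hz v S A w j + ∑ i ∈ R, hs v S A w i * ∏ j ∈ R.erase i, hz v S A w j))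
    (hfar' : (2 : ℝ) < ∑ a ∈ A, (prodBernoulli (fdecouple c Z J v S w)).real (openConn o a) →
      (∀ a ∈ A, (prodBernoulli (fdecouple c Z J v S w)).real (openConn o a)ᶜ ≤ t) →
      (prodBernoulli (fdecouple c Z J v S w)).real {ω : BondConfig (Fin n) | (A.filter fun a => ω ∈ openConn o a).card ≤ 1} ≤ t)
    (hsum : (2 : ℝ) < ∑ a ∈ A, (prodBernoulli w).real (openConn o a))
    (hcut : ∀ a ∈ A, (prodBernoulli w).real (openConn o a)ᶜ ≤ t) :
    (prodBernoulli w).real {ω : BondConfig (Fin n) | (A.filter fun a => ω ∈ openConn o a).card ≤ 1} ≤ t := by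
  obtain ⟨e1, e2⟩ := real_blockCount_law H w A hangS hA
  refine farLayerOne_hubFamily H w A hangS hangZ hA ho hAZ t (fun q hq0 hq => ?_) hfar' hsum hcut
  obtain ⟨l, hl0, hl1, h1, h2⟩ := hdom q hq0 hq
  exact ⟨l, hl0, hl1, by rw [e1]; exact h1, by rw [e2]; exact h2⟩

end Family

end Block

end Quant

end Summit.CriticalPhenomena.PercolationContinuityZ3.Theorems
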